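import Mathlib
import Summits.NavierStokesRegularity.NavierStokesRegularity.Theses.SymmetryModuliCount
import Literature.Analysis.FluidPDE.TypeIAncientMild
import HarnessLib

/-!
# Route SymmetryModuliCount — `SymmetricLiouville → HelicalEndLiouville`
(item stmt-NavierStokesRegularity-14740)

Theorems file closing the support item stmt-NavierStokesRegularity-14740
(`Summit.NavierStokesRegularity.NavierStokesRegularity.Theses.SymmetryModuliCount.HelicalEndLiouvilleOfSymmetricLiouville`)
of route `SymmetryModuliCount` for `NavierStokesRegularity` (Clay A).

The statement is glue between two route decls:

* `SymmetricLiouville` (crux stmt-NavierStokesRegularity-4053): an element `u` of the Type-I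
  KNSS-mild ancient class `A_C` (written out as the four-conjunct of `isTypeIAncientMild_iff`)
  annihilated on the WHOLE past `t < 0` by the generator of a nonzero `ξ = (a, σ, A) ∈ sim(3)`
  (`A` skew) vanishes on `t < 0`;
* `HelicalEndLiouville` (crux stmt-NavierStokesRegularity-14062): an element `u ∈ A_C`
  (`IsTypeIAncientMild C u`) annihilated on a backward END `t < θ` (`θ ≤ 0`) by a Killing generator
  `(a + Ax)·∇ − A` with `A` skew and `a ∉ range A` vanishes on `t < θ`.

Proof (pure logic + the backward time-shift invariance of `A_C`): the shifted field
`v s := u (s − (−θ))` lies in `A_C` (`IsTypeIAncientMild.comp_sub_right` with `δ = −θ ≥ 0`) and is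
annihilated on all of `s < 0` by the same Killing generator, which is the `σ = 0` row of
`SymmetricLiouville`'s symmetry clause (the terms `0 • x`, `0 • v`, `(2·0·s) • ∂ₛv` vanish);
`(a, 0, A) ≠ 0` because `a ∉ range A ∋ A 0 = 0`; so `v ≡ 0` on `s < 0`, and
`u t x = v (t − θ) x = 0` for `t < θ`.

References: Koch–Nadirashvili–Seregin–Šverák 2009, §1 p. 3 (symmetries of the ancient mild class,
arXiv:0709.3599); tree `Literature.Analysis.FluidPDE.IsTypeIAncientMild.comp_sub_right`,
`Literature.Analysis.FluidPDE.isTypeIAncientMild_iff`.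
-/

-- the summit and its single sub-problem share the name (CONVENTIONS §1), as in every Theorems file
set_option linter.dupNamespace false

namespace Summit.NavierStokesRegularity.NavierStokesRegularity.Theorems

/-- **`SymmetricLiouville → HelicalEndLiouville`** (item stmt-NavierStokesRegularity-14740 of route
`SymmetryModuliCount`): the discrete-stabiliser Liouville statement on the whole past implies the
helical / translational Killing leaf on every backward end `t < θ`, `θ ≤ 0`. Shift the field back by
`−θ ≥ 0` (the class `A_C` is invariant, `IsTypeIAncientMild.comp_sub_right`), observe that the
Killing generator `(a + Ax)·∇ − A` is the `σ = 0` row of the similarity generator and that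
`(a, 0, A) ≠ 0` since `a ∉ range A`, apply `SymmetricLiouville` to the shifted field, and shift
forward again. [sources: KNSS2009 §1 p. 3 (arXiv:0709.3599)] -/
theorem symmetryModuliCount_helicalEndLiouvilleOfSymmetricLiouville_proof :
    Summit.NavierStokesRegularity.NavierStokesRegularity.Theses.SymmetryModuliCount.HelicalEndLiouvilleOfSymmetricLiouville := by
  unfold Summit.NavierStokesRegularity.NavierStokesRegularity.Theses.SymmetryModuliCount.HelicalEndLiouvilleOfSymmetricLiouville
  intro hS C u hu a A θ hAs ha hθ hsym t ht x
  -- the backward shift `v s = u (s - (-θ))` stays in the class `A_C`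
  have hv : Literature.Analysis.FluidPDE.IsTypeIAncientMild C (fun s => u (s - (-θ))) :=
    hu.comp_sub_right (neg_nonneg.2 hθ)
  -- `(a, 0, A)` is a nonzero element of `sim(3)` because `a ∉ range A ∋ 0`
  have hne : ¬ (a = 0 ∧ (0 : ℝ) = 0 ∧ A = 0) := by
    rintro ⟨rfl, -, -⟩
    exact ha ⟨0, map_zero A⟩
  -- the Killing clause on the end `t < θ` is the `σ = 0` symmetry clause of `v` on `s < 0`
  have hsym' : ∀ s < (0 : ℝ), ∀ y,
      fderiv ℝ ((fun s => u (s - (-θ))) s) y (a + (0 : ℝ) • y + A y)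
        + (0 : ℝ) • (fun s => u (s - (-θ))) s y
        + (2 * 0 * s) • Literature.Analysis.FluidPDE.timeDeriv (fun s => u (s - (-θ))) s y
        - A ((fun s => u (s - (-θ))) s y) = 0 := by
    intro s hs y
    simp only [zero_smul, add_zero, mul_zero, zero_mul, sub_neg_eq_add]
    exact hsym (s + θ) (by linarith) y
  -- `SymmetricLiouville` kills `v` on `s < 0`; read off `u t = v (t - θ)` with `t - θ < 0`
  have key := hS C (fun s => u (s - (-θ)))
    (Literature.Analysis.FluidPDE.isTypeIAncientMild_iff.1 hv) a 0 A hAs hne hsym'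
    (t - θ) (by linarith) x
  simpa using key

end Summit.NavierStokesRegularity.NavierStokesRegularity.Theorems
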